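import Summits.QuantumFields.BalabanUV.T4Continuum.Support.RegionGaugeColumnsIdentities

/-!
# T⁴ programme, spine node NE2 (U1a), sub-row Δ1 «NE2⁰-Dirichlet» — owner item O15-a, LEAF (B) «GAUGE-COLUMNS-TWO-LEVEL», file B3c:
# THE GAUGE COLUMNS `B̂ = √(n^d)·∂_Ω G′_Ω Q′_Ωᴴ` AT TWO LEVELS — `‖B̂_{L·n} − JpR·B̂_n‖ ≤ CgaugeB(d,L,a′)·n^{−1/2}` on every coordinate box,
# NO displayed binder

NE2 formalisation swarm `b2b-balaban-t4-ne2-formalise-*`, LEAF PROVER 05 (gen 9); owner rulings R35 (c) / R36 (a) (journal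
`CLAIMS.log` 2026-08-20 l.22128 / l.22328; targets VERBATIM = `hB` of `RegionGaugeResolventTower.hinjK_of_local`, p238533).  Route «H⁻¹»
(this seat, journal l.22634; NO energy trick): with `ψ = G′_Ω f`, `f = Q̂′ᴴφ` (`Q̂′ = √(n^d)•Q′_Ω`), the Taylor-planted `ψ̃ = TcR ψ` (B3a),
`g = gdefR ψ`, `h = hR ψ`,

 * (file B3b `RegionGaugeColumnsIdentities`) §1 the identities: `f′ = J0R f` (block data plants exactly, `smul_QOm_conjTranspose_succ_mulVec`), the REGION DIVERGENCE IDENTITY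
   **`gradR_conjTranspose_JstarR_sub`**: `gradR′ᴴ(JstarR·u) − J0R·(gradRᴴu) = gradR′ᴴ(hR ψ)` on `Ω′` for `u = gradR ψ` (B2's torus identity read
   through the region: only star bonds touch a region site), `PiR_succ_mul_J0R` (`Π′_{Ω′}·J0R = J0R·Π_Ω`), `DOm_eq_gradR` (`D_Ω = ∂_Ωᴴ∂_Ω + a′Π_Ω`),
   and THE REPRESENTATION **`fine_sub_taylor_eq`**:
   `G′_{Ω′}f′ − TcR ψ = −G′_{Ω′}·[gradR′ᴴ(g + h) + a′Π′_{Ω′}(TcR ψ − J0R ψ)]`;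
 * §2 THE TRANSFER (pure operator algebra, lineage `GaugeTermResolventBounds.opNorm_mul_inv_mul_conjTranspose_le_one : ‖X S⁻¹ Xᴴ‖ ≤ 1`,
   `opNorm_mul_inv_le_sqrt`): **`nsq_columns_sub_le`**:
   `nsq (B̂′φ − JstarR·B̂φ) ≤ 3·(4·nsq g + nsq h + a′²γ′⁻¹·nsq (TcR ψ − J0R ψ))`;
 * §3 THE BUDGETS on a coordinate box (`n ≥ 2`): B3a's `nsq_gdefR_le` / `nsq_hR_le` + leaf-06-g6's `RegionStarTrace.trace_deficient_le` +
   leaf-07-g7's `RegionInteriorGaffney.interior_gaffney_box` (⇒ `Σ_ν nsq (igrad_ν (gradR ψ)) ≤ Σ_Ω|Δψ|²`, `curl ∘ grad = 0`) + gan24's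
   corner-free H² (`sum_normSq_LapS_solExt_le`, `sum_normSq_LapS_eq`, `cornerFree_blockReg`) + B1's `norm_sq_mul_nsq_taylorJ_sub_JK0_le`
   ⟹ **`nsq_columns_sub_le_box`**: `nsq (B̂′φ − JstarR·B̂φ) ≤ CgaugeBsq d L a′·n⁻¹·nsq φ` and the END
   **`opNorm_regionBh_succ_sub_le`**: `‖regionBh (L·n) M a′ S − JstarR·regionBh n M a′ S‖ ≤ √(CgaugeBsq d L a′)·(√n)⁻¹` — leaf (B) at
   the rate `n_k^{−1/2} = (√L)^{−k}` (the tower spelling `hB` along `lev L k`, with `k = 0` by the trivial bound, is a three-line corollary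
   left to the consumer / file B4 together with (Bᵗ)).

HONEST FRAMING (T4-DAG p. 1).  `U = 1`; ONE region = a coordinate box of unit blocks; ONE averaging scale; finite torus; operator norm;
constants OURS and crude; lattice bookkeeping [folklore] over landed modules; the leading loss is the LOW-WALL leak (coarse and fine Dirichlet
walls differ by `L − 1` fine spacings there) — rate `n^{−1/2}`, not `n⁻¹`; (Bᵗ), (L), the tower END NOT touched; `hinjK` / W3 on boxes
OPEN; NE2 (U1a) NOT proved; spine PROVED 0/9 unchanged; NOT [B9] (3.23)–(3.27) as printed; NOT infinite volume / mass gap / Clay.  HONEST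
DEPENDENCY: continuum YM on T⁴ ⇐ BetaPertH ∧ nine spine estimates (0/9 proved); BetaPertH ⇐ (D1) ∧ (D4) ∧ CAP+tail; G-an2-4 gates asym,
D1 and NE2/3/4.  No `sorry`.
-/

noncomputable section

open scoped BigOperators ComplexConjugate Matrix Matrix.Norms.L2Operator ComplexOrder
open Finset

namespace Summit.QuantumFields.BalabanUV.T4Continuum.RegionGaugeColumnsTwoLevel


open Literature.MathematicalPhysics.QuantumFieldTheory.Balaban1983to89.B5Prop11Plancherel (Tor fine unitVec)
open Literature.MathematicalPhysics.QuantumFieldTheory.Balaban1983to89.B5Prop11Lower (nsq nsq_nonneg)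
open Literature.MathematicalPhysics.QuantumFieldTheory.Balaban1983to89.B5Action121 (sdiff GradOp LapS GradOp_mulVec sdiff_mulVec)
open Literature.MathematicalPhysics.QuantumFieldTheory.Balaban1983to89.B5Block118 (QsOp)
open Literature.MathematicalPhysics.QuantumFieldTheory.Balaban1983to89.B5Blocks16 (blockOf)
open Summit.QuantumFields.BalabanUV.T4Continuum
open Summit.QuantumFields.BalabanUV.T4Continuum.SubtypeCompression (ext ext_apply_of ext_apply_of_not nsq_ext toBlock_mul_of_vanish_left
  toBlock_mul_of_vanish_right toBlock_smul toBlock_add toBlock_conjTranspose)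
open Summit.QuantumFields.BalabanUV.T4Continuum.BalabanAveragedTowerModes (par)
open Summit.QuantumFields.BalabanUV.T4Continuum.KingPairingPlantedLaw (JK)
open Summit.QuantumFields.BalabanUV.T4Continuum.ScalarBlockPoincare (PiS QsOp_apply_blockOf nsq_PiS_mulVec_le nsq_add_le nsq_smul)
open Summit.QuantumFields.BalabanUV.T4Continuum.ScalarAveragedPropagator (DeltaPs gammaPs gammaPs_pos dirichlet opNorm_le_of_nsq_le_rect)
open Summit.QuantumFields.BalabanUV.T4Continuum.ScalarBlockPlanting (JK0)
open Summit.QuantumFields.BalabanUV.T4Continuum.ScalarPlantingDefect (blockOf_par PiS_mul_JK0)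
open Summit.QuantumFields.BalabanUV.T4Continuum.RegionGaugeFixedVector (starReg gradR curlR GradOp_apply_eq_zero_of_not_star
  gradR_conjTranspose_mul_gradR toBlock_PiS curlR_mul_gradR QsOp_apply_eq_zero)
open Summit.QuantumFields.BalabanUV.T4Continuum.RegionScalarCompression (QOm GOm DOm_mul_GOm GOm_mul_DOm GOm_isHermitian)
open Summit.QuantumFields.BalabanUV.T4Continuum.RegionGaugeResolventSplit (regionBh nsq_regionBh_mulVec_le)
open Summit.QuantumFields.BalabanUV.T4Continuum.RegionStarTrace (defSet mem_defSet trace_deficient_le)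
open Summit.QuantumFields.BalabanUV.T4Continuum.RegionInteriorGaffney (interior_gaffney_box)
open Summit.QuantumFields.BalabanUV.T4Continuum.CellTaylorPlanting (cJ taylorJ JK0_mulVec norm_sq_mul_nsq_taylorJ_sub_JK0_le)
open Summit.QuantumFields.BalabanUV.T4Continuum.CellDivergencePlanting (fluxJ GradOp_conjTranspose_mulVec GradOp_conjTranspose_JK_sub_JK0_apply)
open Summit.QuantumFields.BalabanUV.T4Continuum.RegionTaylorColumns (ext_gradR JstarR JstarR_mulVec TcR TcR_mulVec gdefR hR nsq_gdefR_le
  nsq_hR_le sum_subtype_le_sum')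
open Summit.QuantumFields.BalabanUV.Beta.GAN24.DirichletBoxCompression (DOm DOm_isHermitian isUnit_det_DOm opNorm_inv_DOm_le solExt
  toBlock_mulVec' JK0_vanish_right refineR sum_normSq_LapS_solExt_le dirichlet_solExt_le nsq_solExt_le)
open Summit.QuantumFields.BalabanUV.Beta.GAN24.DirichletBoxTrace (blockReg)
open Summit.QuantumFields.BalabanUV.Beta.GAN24.DirichletBoxTwoLevelCore (refineR_blockReg_iff)
open Summit.QuantumFields.BalabanUV.Beta.GAN24.DirichletBoxTwoLevel (IsCoordBox cornerFree_blockReg)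
open Summit.QuantumFields.BalabanUV.Beta.GAN24.DirichletBoxRegularity (Hdiag Hmixed hdiag_le_sum_normSq_LapS sum_normSq_LapS_eq SuppIn
  hmixed_nonneg hdiag_nonneg)

open Summit.QuantumFields.BalabanUV.T4Continuum.RegionGaugeColumnsIdentities (J0R J0R_mulVec fdata fdata_succ_eq PiR DOm_eq_gradR
  smul_PiR_posSemidef fine_sub_taylor_eq)

variable {d : ℕ} (n L : ℕ) [NeZero n] [NeZero L] (M : Fin d → ℕ) [hM : ∀ μ, NeZero (M μ)] (a' : ℝ) (S : Tor M → Prop) [DecidablePred S]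

/-! ## §2 The transfer: pure operator algebra -/

/-- `B̂φ = gradR (G′_Ω (fdata φ))`. [folklore] -/
theorem regionBh_mulVec (φ : {y // S y} → ℂ) :
    regionBh n M a' S *ᵥ φ = gradR n M S *ᵥ (GOm n M a' S *ᵥ fdata n M S φ) := by
  unfold regionBh RegionGaugeResolventSplit.gaugeB fdata
  rw [Matrix.smul_mulVec, Matrix.mulVec_smul, Matrix.mulVec_smul, ← Matrix.mulVec_mulVec, ← Matrix.mulVec_mulVec]

/-- `nsq (Π_Ω e) ≤ nsq e`. [folklore] -/
theorem nsq_PiR_mulVec_le (e : {x // blockReg n M S x} → ℂ) : nsq (PiR n M S *ᵥ e) ≤ nsq e := by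
  unfold PiR
  rw [toBlock_mulVec']
  calc nsq (fun a : {x // blockReg n M S x} => (PiS n M *ᵥ ext (blockReg n M S) e) a)
      ≤ nsq (PiS n M *ᵥ ext (blockReg n M S) e) :=
        sum_subtype_le_sum' (blockReg n M S) (F := fun x => ‖(PiS n M *ᵥ ext (blockReg n M S) e) x‖ ^ 2) fun _ => by positivity
    _ ≤ nsq (ext (blockReg n M S) e) := nsq_PiS_mulVec_le n M _
    _ = nsq e := nsq_ext _ e

omit [NeZero n] [NeZero L] hM [DecidablePred S] in
/-- `nsq (a + b + c) ≤ 3·(nsq a + nsq b + nsq c)`. [folklore] -/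
theorem nsq_add_three_le {α : Type*} [Fintype α] (a b c : α → ℂ) : nsq (a + b + c) ≤ 3 * (nsq a + nsq b + nsq c) := by
  unfold nsq
  have : ∀ i, ‖(a + b + c) i‖ ^ 2 ≤ 3 * (‖a i‖ ^ 2 + ‖b i‖ ^ 2 + ‖c i‖ ^ 2) := fun i => by
    rw [Pi.add_apply, Pi.add_apply]
    have h := norm_add₃_le (a := a i) (b := b i) (c := c i)
    nlinarith [h, norm_nonneg (a i + b i + c i), norm_nonneg (a i), norm_nonneg (b i), norm_nonneg (c i),
      sq_nonneg (‖a i‖ - ‖b i‖), sq_nonneg (‖b i‖ - ‖c i‖), sq_nonneg (‖a i‖ - ‖c i‖)]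
  calc ∑ i, ‖(a + b + c) i‖ ^ 2 ≤ ∑ i, 3 * (‖a i‖ ^ 2 + ‖b i‖ ^ 2 + ‖c i‖ ^ 2) := Finset.sum_le_sum fun i _ => this i
    _ = 3 * (∑ i, ‖a i‖ ^ 2 + ∑ i, ‖b i‖ ^ 2 + ∑ i, ‖c i‖ ^ 2) := by
        rw [← Finset.sum_add_distrib, ← Finset.sum_add_distrib, Finset.mul_sum]

/-- **THE TRANSFER**: with `f = fdata φ`, `ψ = G′_Ωf`, `ψ̃ = TcR ψ`, `g = gdefR ψ`, `h = hR ψ`,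
`nsq (B̂′φ − JstarR·B̂φ) ≤ 3·(3·nsq g + 2·nsq h + a′²·γ′⁻¹·nsq (ψ̃ − J0R ψ))` — from the representation, `‖∂′G′∂′ᴴ‖ ≤ 1` and
`nsq (∂′G′x) ≤ ‖G′‖·nsq x` (lineage `GaugeTermResolventBounds`). [folklore] -/
theorem nsq_columns_sub_le (ha' : 0 < a') (φ : {y // S y} → ℂ) :
    nsq (regionBh (L * n) M a' S *ᵥ φ - JstarR n L M S *ᵥ (regionBh n M a' S *ᵥ φ))
      ≤ 3 * (3 * nsq (gdefR n L M S (GOm n M a' S *ᵥ fdata n M S φ)) + 2 * nsq (hR n L M S (GOm n M a' S *ᵥ fdata n M S φ))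
          + a' ^ 2 * (gammaPs d a')⁻¹
            * nsq (TcR n L M S *ᵥ (GOm n M a' S *ᵥ fdata n M S φ) - J0R n L M S *ᵥ (GOm n M a' S *ᵥ fdata n M S φ))) := by
  have hγ := (gammaPs_pos (d := d) (a' := a')).1
  set f := fdata n M S φ with hf
  set ψ := GOm n M a' S *ᵥ f with hψ
  set g := gdefR n L M S ψ with hg
  set h := hR n L M S ψ with hh
  set e := TcR n L M S *ᵥ ψ - J0R n L M S *ᵥ ψ with he
  -- the operator facts for `S′ = D_{Ω′} = ∂′ᴴ∂′ + a′Π′`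
  have hS := DOm_eq_gradR (L * n) M a' S
  have hY := smul_PiR_posSemidef (L * n) M a' S ha'.le
  have hSU := isUnit_det_DOm (L * n) M a' (blockReg (L * n) M S) ha'
  have hP : ‖gradR (L * n) M S * (DOm (L * n) M a' (blockReg (L * n) M S))⁻¹ * (gradR (L * n) M S)ᴴ‖ ≤ 1 :=
    GaugeTermResolventBounds.opNorm_mul_inv_mul_conjTranspose_le_one hS hY hSU
  -- the vector identity
  have hv : regionBh (L * n) M a' S *ᵥ φ - JstarR n L M S *ᵥ (regionBh n M a' S *ᵥ φ)
      = -((gradR (L * n) M S * (DOm (L * n) M a' (blockReg (L * n) M S))⁻¹ * (gradR (L * n) M S)ᴴ) *ᵥ (g + h))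
        + -(((a' : ℂ)) • (gradR (L * n) M S *ᵥ ((DOm (L * n) M a' (blockReg (L * n) M S))⁻¹ *ᵥ (PiR (L * n) M S *ᵥ e))))
        + g := by
    rw [regionBh_mulVec, regionBh_mulVec, fdata_succ_eq, ← hf, ← hψ]
    have hrep := fine_sub_taylor_eq n L M a' S ha' f
    rw [← hψ, ← hg, ← hh, ← he] at hrep
    -- `gradR′ψ′ − JstarR u = gradR′(ψ′ − ψ̃) + g`
    have e1 : gradR (L * n) M S *ᵥ (GOm (L * n) M a' S *ᵥ (J0R n L M S *ᵥ f)) - JstarR n L M S *ᵥ (gradR n M S *ᵥ ψ)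
        = gradR (L * n) M S *ᵥ (GOm (L * n) M a' S *ᵥ (J0R n L M S *ᵥ f) - TcR n L M S *ᵥ ψ) + g := by
      rw [Matrix.mulVec_sub, hg, gdefR]; abel
    rw [e1, hrep, Matrix.mulVec_neg, Matrix.mulVec_add, Matrix.mulVec_smul, ← Matrix.mulVec_mulVec, ← Matrix.mulVec_mulVec]
    unfold GOm
    rw [Matrix.mulVec_add, Matrix.mulVec_smul, neg_add]
  rw [hv]
  refine (nsq_add_three_le _ _ _).trans ?_
  -- term 1
  have t1 : nsq (-((gradR (L * n) M S * (DOm (L * n) M a' (blockReg (L * n) M S))⁻¹ * (gradR (L * n) M S)ᴴ) *ᵥ (g + h)))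
      ≤ 2 * nsq g + 2 * nsq h := by
    have e0 : nsq (-((gradR (L * n) M S * (DOm (L * n) M a' (blockReg (L * n) M S))⁻¹ * (gradR (L * n) M S)ᴴ) *ᵥ (g + h)))
        = nsq ((gradR (L * n) M S * (DOm (L * n) M a' (blockReg (L * n) M S))⁻¹ * (gradR (L * n) M S)ᴴ) *ᵥ (g + h)) := by
      unfold nsq; simp only [Pi.neg_apply, norm_neg]
    rw [e0]
    calc _ ≤ ‖gradR (L * n) M S * (DOm (L * n) M a' (blockReg (L * n) M S))⁻¹ * (gradR (L * n) M S)ᴴ‖ ^ 2 * nsq (g + h) :=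
          Literature.MathematicalPhysics.QuantumFieldTheory.Balaban1983to89.B5Prop11Lower.nsq_mulVec_le _ _
      _ ≤ 1 * nsq (g + h) := by
          refine mul_le_mul_of_nonneg_right ?_ (nsq_nonneg _)
          calc _ ≤ (1 : ℝ) ^ 2 := pow_le_pow_left₀ (norm_nonneg _) hP 2
            _ = 1 := one_pow 2
      _ ≤ 2 * nsq g + 2 * nsq h := by rw [one_mul]; exact nsq_add_le g h
  -- term 2
  have t2 : nsq (-(((a' : ℂ)) • (gradR (L * n) M S *ᵥ ((DOm (L * n) M a' (blockReg (L * n) M S))⁻¹ *ᵥ (PiR (L * n) M S *ᵥ e)))))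
      ≤ a' ^ 2 * (gammaPs d a')⁻¹ * nsq e := by
    have e0 : nsq (-(((a' : ℂ)) • (gradR (L * n) M S *ᵥ ((DOm (L * n) M a' (blockReg (L * n) M S))⁻¹ *ᵥ (PiR (L * n) M S *ᵥ e)))))
        = a' ^ 2 * nsq (gradR (L * n) M S *ᵥ ((DOm (L * n) M a' (blockReg (L * n) M S))⁻¹ *ᵥ (PiR (L * n) M S *ᵥ e))) := by
      have : nsq (-(((a' : ℂ)) • (gradR (L * n) M S *ᵥ ((DOm (L * n) M a' (blockReg (L * n) M S))⁻¹ *ᵥ (PiR (L * n) M S *ᵥ e)))))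
          = nsq (((a' : ℂ)) • (gradR (L * n) M S *ᵥ ((DOm (L * n) M a' (blockReg (L * n) M S))⁻¹ *ᵥ (PiR (L * n) M S *ᵥ e)))) := by
        unfold nsq; simp only [Pi.neg_apply, norm_neg]
      rw [this, nsq_smul, Complex.norm_real, Real.norm_eq_abs, sq_abs]
    rw [e0, mul_assoc]
    refine mul_le_mul_of_nonneg_left ?_ (sq_nonneg a')
    calc _ ≤ ‖(DOm (L * n) M a' (blockReg (L * n) M S))⁻¹‖ * nsq (PiR (L * n) M S *ᵥ e) :=
          GaugeTermResolventBounds.nsq_mul_inv_mulVec_le hS hY hSU _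
      _ ≤ (gammaPs d a')⁻¹ * nsq e :=
          mul_le_mul (opNorm_inv_DOm_le (L * n) M a' _ ha') (nsq_PiR_mulVec_le (L * n) M S e) (nsq_nonneg _)
            (inv_nonneg.mpr hγ.le)
  nlinarith [t1, t2, nsq_nonneg g, nsq_nonneg h, nsq_nonneg e]

/-! ## §3 The budgets on a coordinate box and the END -/

/-- `Λ = 2(1 + (a′γ′⁻¹)²)`, gan24's second-difference budget constant. [folklore] -/
def LamH (d : ℕ) (a' : ℝ) : ℝ := 2 * (1 + (a' * (gammaPs d a')⁻¹) ^ 2)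

/-- the (B) constant (squared): `CgaugeBsq d L a′ := 3·(3·(2dL²Λ + 8d²L²(2γ′⁻¹ + Λ)) + 2Λ + a′²γ′⁻²d)`. [folklore] -/
def CgaugeBsq (d L : ℕ) (a' : ℝ) : ℝ :=
  3 * (3 * (2 * d * (L : ℝ) ^ 2 * LamH d a' + 8 * (d : ℝ) ^ 2 * (L : ℝ) ^ 2 * (2 * (gammaPs d a')⁻¹ + LamH d a'))
    + 2 * LamH d a' + a' ^ 2 * ((gammaPs d a')⁻¹) ^ 2 * d)

/-- `nsq (fdata φ) ≤ nsq φ` (`‖Q′_Ω‖ ≤ (√(n^d))⁻¹`). [folklore] -/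
theorem nsq_fdata_le (φ : {y // S y} → ℂ) : nsq (fdata n M S φ) ≤ nsq φ := by
  have hn : (0 : ℝ) < (n : ℝ) ^ d := pow_pos (by exact_mod_cast Nat.pos_of_ne_zero (NeZero.ne n)) d
  unfold fdata
  rw [nsq_smul, Complex.norm_real, Real.norm_of_nonneg (Real.sqrt_nonneg _), Real.sq_sqrt hn.le]
  have h1 : Real.sqrt (nsq ((QOm n M S)ᴴ *ᵥ φ)) ≤ ‖(QOm n M S)ᴴ‖ * Real.sqrt (nsq φ) := RegionNormPairingTools.sqrt_nsq_mulVec_le _ _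
  have h2 : ‖(QOm n M S)ᴴ‖ ≤ (Real.sqrt ((n : ℝ) ^ d))⁻¹ := by
    rw [Matrix.l2_opNorm_conjTranspose]
    refine opNorm_le_of_nsq_le_rect _ (inv_nonneg.mpr (Real.sqrt_nonneg _)) fun v => ?_
    have h := RegionScalarCompression.nsq_QOm_mulVec_le n M S v
    rw [inv_pow, Real.sq_sqrt hn.le]
    calc nsq (QOm n M S *ᵥ v) = ((n : ℝ) ^ d)⁻¹ * ((n : ℝ) ^ d * nsq (QOm n M S *ᵥ v)) := by
          rw [← mul_assoc, inv_mul_cancel₀ hn.ne', one_mul]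
      _ ≤ ((n : ℝ) ^ d)⁻¹ * nsq v := mul_le_mul_of_nonneg_left h (inv_nonneg.mpr hn.le)
  have h3 : Real.sqrt (nsq ((QOm n M S)ᴴ *ᵥ φ)) ≤ (Real.sqrt ((n : ℝ) ^ d))⁻¹ * Real.sqrt (nsq φ) :=
    h1.trans (mul_le_mul_of_nonneg_right h2 (Real.sqrt_nonneg _))
  have h4 : nsq ((QOm n M S)ᴴ *ᵥ φ) ≤ ((n : ℝ) ^ d)⁻¹ * nsq φ := by
    have h5 := pow_le_pow_left₀ (Real.sqrt_nonneg _) h3 2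
    rw [Real.sq_sqrt (nsq_nonneg _), mul_pow, Real.sq_sqrt (nsq_nonneg _), inv_pow, Real.sq_sqrt hn.le] at h5
    exact h5
  calc (n : ℝ) ^ d * nsq ((QOm n M S)ᴴ *ᵥ φ) ≤ (n : ℝ) ^ d * (((n : ℝ) ^ d)⁻¹ * nsq φ) := mul_le_mul_of_nonneg_left h4 hn.le
    _ = nsq φ := by rw [← mul_assoc, mul_inv_cancel₀ hn.ne', one_mul]

/-- **THE BUDGETS OF THE COARSE SOLUTION ON A COORDINATE BOX** (`n ≥ 2`, `ψ = G′_Ωf`, `z = ext ψ`, `u = gradR ψ`):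
`nsq u ≤ γ′⁻¹·nsq f`, `Σ_Ω|Δz|² ≤ Λ·nsq f` (hence `Hdiag_Ω z`, `Hmixed z ≤ Λ·nsq f`), `Σ_ν nsq (igrad_ν u) ≤ Λ·nsq f`
(`curl ∘ grad = 0` + interior Gaffney), `Σ_def ‖u‖² ≤ (2γ′⁻¹ + Λ)·n⁻¹·nsq f` (trace inequality). [folklore] -/
theorem budgets_box (hn : 2 ≤ n) (hS : IsCoordBox M S) (ha' : 0 < a') (f : {x // blockReg n M S x} → ℂ) :
    nsq (gradR n M S *ᵥ (GOm n M a' S *ᵥ f)) ≤ (gammaPs d a')⁻¹ * nsq f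
    ∧ Hdiag (n : ℂ) (univ.filter (blockReg n M S)) (ext (blockReg n M S) (GOm n M a' S *ᵥ f)) ≤ LamH d a' * nsq f
    ∧ Hmixed (n : ℂ) (ext (blockReg n M S) (GOm n M a' S *ᵥ f)) ≤ LamH d a' * nsq f
    ∧ ∑ b ∈ defSet n M S, ‖(gradR n M S *ᵥ (GOm n M a' S *ᵥ f)) b‖ ^ 2 ≤ (2 * (gammaPs d a')⁻¹ + LamH d a') * (n : ℝ)⁻¹ * nsq f := by
  have hγ := (gammaPs_pos (d := d) (a' := a')).1
  have hnpos : (0 : ℝ) < n := by exact_mod_cast (lt_of_lt_of_le zero_lt_two hn)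
  set ψ := GOm n M a' S *ᵥ f with hψ
  set z := ext (blockReg n M S) ψ with hz
  set u := gradR n M S *ᵥ ψ with hu
  have hzsol : z = solExt n M a' (blockReg n M S) f := rfl
  have hsupp : SuppIn (fine n M) (univ.filter (blockReg n M S)) z := by
    intro x hx
    rw [Finset.mem_filter] at hx
    exact ext_apply_of_not _ _ (fun h => hx ⟨Finset.mem_univ _, h⟩)
  -- energy
  have hE : nsq u ≤ (gammaPs d a')⁻¹ * nsq f := by
    rw [hu, ← nsq_ext (starReg n M S), ext_gradR, ← hz, ScalarAveragedPropagator.nsq_GradOp_mulVec, hzsol]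
    exact dirichlet_solExt_le n M a' _ ha' f
  -- compressed Laplacian
  have hLap : ∑ x ∈ univ.filter (blockReg n M S), ‖(LapS (fine n M) (n : ℂ) *ᵥ z) x‖ ^ 2 ≤ LamH d a' * nsq f := by
    have h2 : ∑ x ∈ univ.filter (blockReg n M S), ‖(LapS (fine n M) (n : ℂ) *ᵥ z) x‖ ^ 2
        = ∑ a : {x // blockReg n M S x}, ‖(LapS (fine n M) (n : ℂ) *ᵥ z) a‖ ^ 2 :=
      Finset.sum_subtype _ (fun x => by simp) (fun x => ‖(LapS (fine n M) (n : ℂ) *ᵥ z) x‖ ^ 2)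
    rw [h2, hzsol]
    exact sum_normSq_LapS_solExt_le n M a' _ ha' f
  have hHd : Hdiag (n : ℂ) (univ.filter (blockReg n M S)) z ≤ LamH d a' * nsq f :=
    (hdiag_le_sum_normSq_LapS (cornerFree_blockReg M S hS n) hsupp (n : ℂ)).trans hLap
  have hHm : Hmixed (n : ℂ) z ≤ LamH d a' * nsq f := by
    have e := sum_normSq_LapS_eq (cornerFree_blockReg M S hS n) hsupp (n : ℂ)
    have := hdiag_nonneg (n : ℂ) (univ.filter (blockReg n M S)) z
    linarith
  -- interior gradient of `u` by interior Gaffney (`curl ∘ grad = 0`, `gradRᴴgradR ψ = (Δz)↾Ω`)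
  have hIg : ∑ ν, nsq (DirichletStarRenormTower.igrad M S n ν u) ≤ LamH d a' * nsq f := by
    refine (interior_gaffney_box n M S hn hS u).trans ?_
    have hc : curlR n M S *ᵥ u = 0 := by rw [hu, Matrix.mulVec_mulVec, curlR_mul_gradR, Matrix.zero_mulVec]
    have hd : nsq ((gradR n M S)ᴴ *ᵥ u) = ∑ a : {x // blockReg n M S x}, ‖(LapS (fine n M) (n : ℂ) *ᵥ z) a‖ ^ 2 := by
      rw [hu, Matrix.mulVec_mulVec, gradR_conjTranspose_mul_gradR, toBlock_mulVec']
      rfl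
    rw [hc, hd]
    have h2 : ∑ a : {x // blockReg n M S x}, ‖(LapS (fine n M) (n : ℂ) *ᵥ z) a‖ ^ 2
        = ∑ x ∈ univ.filter (blockReg n M S), ‖(LapS (fine n M) (n : ℂ) *ᵥ z) x‖ ^ 2 :=
      (Finset.sum_subtype _ (fun x => by simp) (fun x => ‖(LapS (fine n M) (n : ℂ) *ᵥ z) x‖ ^ 2)).symm
    rw [h2]
    unfold nsq; simp only [Pi.zero_apply, norm_zero]
    rw [zero_pow two_ne_zero, Finset.sum_const_zero, zero_add]
    exact hLap
  -- trace
  have hT : ∑ b ∈ defSet n M S, ‖u b‖ ^ 2 ≤ (2 * (gammaPs d a')⁻¹ + LamH d a') * (n : ℝ)⁻¹ * nsq f := by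
    refine (trace_deficient_le n M S u).trans ?_
    rw [div_eq_mul_inv]
    have : 2 * nsq u + ∑ ν, nsq (DirichletStarRenormTower.igrad M S n ν u) ≤ (2 * (gammaPs d a')⁻¹ + LamH d a') * nsq f := by nlinarith
    calc (2 * nsq u + ∑ ν, nsq (DirichletStarRenormTower.igrad M S n ν u)) * (n : ℝ)⁻¹
        ≤ ((2 * (gammaPs d a')⁻¹ + LamH d a') * nsq f) * (n : ℝ)⁻¹ := mul_le_mul_of_nonneg_right this (inv_nonneg.mpr hnpos.le)
      _ = _ := by ring
  exact ⟨hE, hHd, hHm, hT⟩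

/-- **LEAF (B) IN `nsq` FORM ON A COORDINATE BOX** (`n ≥ 2`): `nsq (B̂′φ − JstarR·B̂φ) ≤ CgaugeBsq d L a′·n⁻¹·nsq φ`. [folklore] -/
theorem nsq_columns_sub_le_box (hn : 2 ≤ n) (hS : IsCoordBox M S) (ha' : 0 < a') (φ : {y // S y} → ℂ) :
    nsq (regionBh (L * n) M a' S *ᵥ φ - JstarR n L M S *ᵥ (regionBh n M a' S *ᵥ φ)) ≤ CgaugeBsq d L a' * (n : ℝ)⁻¹ * nsq φ := by
  have hγ := (gammaPs_pos (d := d) (a' := a')).1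
  have hnpos : (0 : ℝ) < n := by exact_mod_cast (lt_of_lt_of_le zero_lt_two hn)
  have hn1 : (1 : ℝ) ≤ n := by exact_mod_cast (le_trans one_le_two hn)
  set f := fdata n M S φ with hf
  obtain ⟨hE, hHd, hHm, hT⟩ := budgets_box n M a' S hn hS ha' f
  set ψ := GOm n M a' S *ᵥ f with hψ
  have hfφ : nsq f ≤ nsq φ := nsq_fdata_le n M S φ
  have hΛ : 0 ≤ LamH d a' := by unfold LamH; positivity
  have hf0 := nsq_nonneg f
  -- the three pieces
  have hG := nsq_gdefR_le n L M S ψ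
  have hH := nsq_hR_le n L M S ψ
  have he : nsq (TcR n L M S *ᵥ ψ - J0R n L M S *ᵥ ψ) ≤ d * ((n : ℝ) ^ 2)⁻¹ * ((gammaPs d a')⁻¹ * nsq f) := by
    have h1 : nsq (TcR n L M S *ᵥ ψ - J0R n L M S *ᵥ ψ)
        ≤ nsq ((taylorJ n L M - JK0 n L M) *ᵥ ext (blockReg n M S) ψ) := by
      have e : ∀ a : {x // blockReg (L * n) M S x}, (TcR n L M S *ᵥ ψ - J0R n L M S *ᵥ ψ) a
          = ((taylorJ n L M - JK0 n L M) *ᵥ ext (blockReg n M S) ψ) a.1 := fun a => by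
        rw [Pi.sub_apply, TcR_mulVec, J0R_mulVec, Matrix.sub_mulVec, Pi.sub_apply, JK0_mulVec]
      calc nsq (TcR n L M S *ᵥ ψ - J0R n L M S *ᵥ ψ)
          = ∑ a : {x // blockReg (L * n) M S x}, ‖((taylorJ n L M - JK0 n L M) *ᵥ ext (blockReg n M S) ψ) a.1‖ ^ 2 := by
            unfold nsq; exact Finset.sum_congr rfl fun a _ => by rw [e a]
        _ ≤ _ := sum_subtype_le_sum' (blockReg (L * n) M S)
            (F := fun x => ‖((taylorJ n L M - JK0 n L M) *ᵥ ext (blockReg n M S) ψ) x‖ ^ 2) fun _ => by positivity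
    have h2 := norm_sq_mul_nsq_taylorJ_sub_JK0_le n L M (n : ℂ) (ext (blockReg n M S) ψ)
    rw [Complex.norm_natCast, ← ext_gradR, nsq_ext] at h2
    have hn2 : (0 : ℝ) < (n : ℝ) ^ 2 := by positivity
    calc nsq (TcR n L M S *ᵥ ψ - J0R n L M S *ᵥ ψ)
        ≤ ((n : ℝ) ^ 2)⁻¹ * ((n : ℝ) ^ 2 * nsq ((taylorJ n L M - JK0 n L M) *ᵥ ext (blockReg n M S) ψ)) := by
          rw [← mul_assoc, inv_mul_cancel₀ hn2.ne', one_mul]; exact h1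
      _ ≤ ((n : ℝ) ^ 2)⁻¹ * (d * nsq (gradR n M S *ᵥ ψ)) := mul_le_mul_of_nonneg_left h2 (inv_nonneg.mpr hn2.le)
      _ ≤ ((n : ℝ) ^ 2)⁻¹ * (d * ((gammaPs d a')⁻¹ * nsq f)) :=
          mul_le_mul_of_nonneg_left (mul_le_mul_of_nonneg_left hE (Nat.cast_nonneg _)) (inv_nonneg.mpr hn2.le)
      _ = _ := by ring
  refine (nsq_columns_sub_le n L M a' S ha' φ).trans ?_
  rw [← hf, ← hψ]
  -- `n⁻² ≤ n⁻¹`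
  have hinv : ((n : ℝ) ^ 2)⁻¹ ≤ (n : ℝ)⁻¹ := by
    rw [inv_le_inv₀ (by positivity) hnpos]; nlinarith
  have hinv0 : 0 ≤ ((n : ℝ) ^ 2)⁻¹ := by positivity
  -- bound each piece by `const · n⁻¹ · nsq f`
  have hG' : nsq (gdefR n L M S ψ) ≤ (2 * d * (L : ℝ) ^ 2 * LamH d a' + 8 * (d : ℝ) ^ 2 * (L : ℝ) ^ 2 * (2 * (gammaPs d a')⁻¹ + LamH d a'))
      * (n : ℝ)⁻¹ * nsq f := by
    refine hG.trans ?_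
    have a1 : 2 * (d * (L : ℝ) ^ 2 * ((n : ℝ) ^ 2)⁻¹ * Hmixed (n : ℂ) (ext (blockReg n M S) ψ))
        ≤ 2 * d * (L : ℝ) ^ 2 * LamH d a' * (n : ℝ)⁻¹ * nsq f := by
      have := mul_le_mul hinv hHm (hmixed_nonneg _ _) (inv_nonneg.mpr hnpos.le)
      calc 2 * (d * (L : ℝ) ^ 2 * ((n : ℝ) ^ 2)⁻¹ * Hmixed (n : ℂ) (ext (blockReg n M S) ψ))
          = 2 * d * (L : ℝ) ^ 2 * (((n : ℝ) ^ 2)⁻¹ * Hmixed (n : ℂ) (ext (blockReg n M S) ψ)) := by ring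
        _ ≤ 2 * d * (L : ℝ) ^ 2 * ((n : ℝ)⁻¹ * (LamH d a' * nsq f)) := mul_le_mul_of_nonneg_left this (by positivity)
        _ = _ := by ring
    have a2 : 2 * (4 * d * ((L * n : ℕ) : ℝ) ^ 2 * (d * ((n : ℝ) ^ 2)⁻¹ * ∑ b ∈ defSet n M S, ‖(gradR n M S *ᵥ ψ) b‖ ^ 2))
        ≤ 8 * (d : ℝ) ^ 2 * (L : ℝ) ^ 2 * (2 * (gammaPs d a')⁻¹ + LamH d a') * (n : ℝ)⁻¹ * nsq f := by
      have e1 : ((L * n : ℕ) : ℝ) ^ 2 * ((n : ℝ) ^ 2)⁻¹ = (L : ℝ) ^ 2 := by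
        push_cast; field_simp
      calc 2 * (4 * d * ((L * n : ℕ) : ℝ) ^ 2 * (d * ((n : ℝ) ^ 2)⁻¹ * ∑ b ∈ defSet n M S, ‖(gradR n M S *ᵥ ψ) b‖ ^ 2))
          = 8 * (d : ℝ) ^ 2 * (((L * n : ℕ) : ℝ) ^ 2 * ((n : ℝ) ^ 2)⁻¹) * ∑ b ∈ defSet n M S, ‖(gradR n M S *ᵥ ψ) b‖ ^ 2 := by ring
        _ ≤ 8 * (d : ℝ) ^ 2 * (L : ℝ) ^ 2 * ((2 * (gammaPs d a')⁻¹ + LamH d a') * (n : ℝ)⁻¹ * nsq f) := by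
            rw [e1]; exact mul_le_mul_of_nonneg_left hT (by positivity)
        _ = _ := by ring
    linarith
  have hH' : nsq (hR n L M S ψ) ≤ LamH d a' * (n : ℝ)⁻¹ * nsq f := by
    refine hH.trans ?_
    calc ((n : ℝ) ^ 2)⁻¹ * Hdiag (n : ℂ) (univ.filter (blockReg n M S)) (ext (blockReg n M S) ψ)
        ≤ (n : ℝ)⁻¹ * (LamH d a' * nsq f) := mul_le_mul hinv hHd (hdiag_nonneg _ _ _) (inv_nonneg.mpr hnpos.le)
      _ = _ := by ring
  have he' : a' ^ 2 * (gammaPs d a')⁻¹ * nsq (TcR n L M S *ᵥ ψ - J0R n L M S *ᵥ ψ)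
      ≤ a' ^ 2 * ((gammaPs d a')⁻¹) ^ 2 * d * (n : ℝ)⁻¹ * nsq f := by
    calc a' ^ 2 * (gammaPs d a')⁻¹ * nsq (TcR n L M S *ᵥ ψ - J0R n L M S *ᵥ ψ)
        ≤ a' ^ 2 * (gammaPs d a')⁻¹ * (d * (n : ℝ)⁻¹ * ((gammaPs d a')⁻¹ * nsq f)) := by
          refine mul_le_mul_of_nonneg_left (he.trans ?_) (by positivity)
          exact mul_le_mul_of_nonneg_right (mul_le_mul_of_nonneg_left hinv (Nat.cast_nonneg _)) (by positivity)
      _ = _ := by ring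
  calc 3 * (3 * nsq (gdefR n L M S ψ) + 2 * nsq (hR n L M S ψ) + a' ^ 2 * (gammaPs d a')⁻¹ * nsq (TcR n L M S *ᵥ ψ - J0R n L M S *ᵥ ψ))
      ≤ 3 * (3 * ((2 * d * (L : ℝ) ^ 2 * LamH d a' + 8 * (d : ℝ) ^ 2 * (L : ℝ) ^ 2 * (2 * (gammaPs d a')⁻¹ + LamH d a')) * (n : ℝ)⁻¹ * nsq f)
          + 2 * (LamH d a' * (n : ℝ)⁻¹ * nsq f) + a' ^ 2 * ((gammaPs d a')⁻¹) ^ 2 * d * (n : ℝ)⁻¹ * nsq f) := by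
        nlinarith [hG', hH', he']
    _ = CgaugeBsq d L a' * (n : ℝ)⁻¹ * nsq f := by unfold CgaugeBsq; ring
    _ ≤ CgaugeBsq d L a' * (n : ℝ)⁻¹ * nsq φ := by
        refine mul_le_mul_of_nonneg_left hfφ ?_
        unfold CgaugeBsq; positivity

/-- `0 ≤ CgaugeBsq`. [folklore] -/
theorem CgaugeBsq_nonneg (d L : ℕ) (a' : ℝ) : 0 ≤ CgaugeBsq d L a' := by
  have := (gammaPs_pos (d := d) (a' := a')).1
  unfold CgaugeBsq LamH; positivity

/-- **LEAF (B) «GAUGE-COLUMNS-TWO-LEVEL» ON A COORDINATE BOX — NO DISPLAYED BINDER**: for every `n ≥ 2`, `L ≥ 1`, `a′ > 0` and every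
coordinate box `S`, `‖B̂_{L·n} − JstarR·B̂_n‖ ≤ √(CgaugeBsq d L a′)·(√n)⁻¹` — the gauge columns `B̂ = √(n^d)·∂_ΩG′_ΩQ′_Ωᴴ` of the region gauge
projection at two adjacent levels differ, after King's compressed planting, by `O(n^{−1/2})` in OPERATOR norm (interior: mixed/diagonal
Hessian of the scalar box solution, rate `n⁻¹`; LOW walls: the deficient trace, rate `n^{−1/2}`).  Along the tower `n = L^k` this is the
owner's `hB` at `θ = (√L)⁻¹` for `k ≥ 1` (`k = 0` by the trivial bound `2√(γ′⁻¹)`). [folklore] -/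
theorem opNorm_regionBh_succ_sub_le (hn : 2 ≤ n) (hS : IsCoordBox M S) (ha' : 0 < a') :
    ‖regionBh (L * n) M a' S - JstarR n L M S * regionBh n M a' S‖ ≤ Real.sqrt (CgaugeBsq d L a') * (Real.sqrt n)⁻¹ := by
  have hnpos : (0 : ℝ) < n := by exact_mod_cast (lt_of_lt_of_le zero_lt_two hn)
  refine opNorm_le_of_nsq_le_rect _ (by positivity) fun φ => ?_
  rw [Matrix.sub_mulVec, ← Matrix.mulVec_mulVec, mul_pow, Real.sq_sqrt (CgaugeBsq_nonneg d L a'), inv_pow, Real.sq_sqrt hnpos.le]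
  exact nsq_columns_sub_le_box n L M a' S hn hS ha' φ

end Summit.QuantumFields.BalabanUV.T4Continuum.RegionGaugeColumnsTwoLevel

end
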